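import Summits.Ventures.DiscreteObjects.UnitDistance.UnitCircleGraph
import Mathlib.Data.ZMod.Basic
import Summits.Ventures.DiscreteObjects.UnitDistance.FiniteFieldLowerBoundF11
import Summits.Ventures.DiscreteObjects.UnitDistance.FiniteFieldLowerBoundF19
import Mathlib.Combinatorics.SimpleGraph.Clique
import Mathlib.GroupTheory.Index
import Summits.Ventures.DiscreteObjects.UnitDistance.UnitQuadranceIndependence
import HarnessLib

/-!
# The reduction tower `G_k(p) = unitCircleGraph (ℤ/p^k)`: independence numbers lift (`p²·α(G_k) ≤ α(G_{k+1})`) and Cioabă's conjecture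
(cell `pub-namedobj`, target (U), seat udg g20 — companion of `PadicHigherReduction.lean` / `PadicAllOrders.lean`)

Framing (verbatim for the cell): lottery ticket; floor = certified bounds/negative ranges.

`G_k(p) := unitCircleGraph (ZMod (p^k)) = Cay((ℤ/p^k)², {a² + b² = 1})` is the finite Euclidean graph `X_{p^k}(2,1)` over the ring `ℤ/p^k`
of Medrano–Myers–Stark–Terras (Proc. AMS 126 (1998) 701–712).  Reduction `ℤ/p^{k+1} → ℤ/p^k` is a graph homomorphism `G_{k+1}(p) → G_k(p)` whose
vertex fibres all have exactly `p²` points, so (THEOREM, replication of S. M. Cioabă, PhD thesis "Eigenvalues, Expanders and Gaps between Primes",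
Queen's University 2005, Theorem 4.3.7, the case `n = 2`, `a = 1`):
`χ(G_{k+1}(p)) ≤ χ(G_k(p))` (in the tree: `unitCircleGraph_zmodPow_colorable_mono`) and `p² · α(G_k(p)) ≤ α(G_{k+1}(p))`
(`sq_mul_indepNum_le_indepNum_succ` below; pulled-back independent sets are independent, `mul_indepNum_le_indepNum_of_hom`, and the fibres have `p²` points, `card_fiber_zmodPow_reduce₂`).  Cioabă adds (loc. cit., p. 56): "I believe that
equality holds in both of the previous results."  For the cell this belief — appearing below only as HYPOTHESES `hα`/`hχ` of theorems, never asserted —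
is exactly seat udg g19's 'lift conjecture' `α(G_{k+1}(p)) = p²·α(G_k(p))` (HOME pub-namedobj-udg-g19/THEORY-U19-lift.md: grid lemma, exact at
`p = 3`, `k = 1 → 2`), found in print by this seat's literature pass.  Its chromatic half at `p = 11` and `p = 19` says that NO reduction modulo
any power of `11` or `19` is `4`-colourable (`not_colorable_four_zmodPow11_of_chromatic_lift`, `…19…`; and from the α-half plus `α(UD(𝔽₁₁²)) ≤ 30`: `not_colorable_four_zmodPow11_of_indep_lift`), i.e. that the hypotheses of the conditional row
theorems `chromaticNumber_plane_sqrt47_eq_four_of_zmodPow` & co. of `PadicHigherReduction.lean` can never be met: under Cioabă's conjecture the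
rows `χ(ℚ(√d)²) ∈ {4,5}`, `d = 47, 311, 335`, are decidable only by a `5`-chromatic witness or by a NON-periodic `4`-colouring
(`reduction_route_closed_of_chromatic_lift`).  CAVEAT recorded for the planner: Cioabă states the belief for all dimensions `n`; for `n = 1` it is false
(`X_{p^k}(1,1)` is the cycle `C_{p^k}` for odd `p`, and `α(C_{p^{k+1}}) = (p^{k+1} − 1)/2 > p·α(C_{p^k})`), so any proof must use the
two-dimensional stripe structure (complete bipartite joins between matched stripes of adjacent fibres, udg g19's grid lemma).
Unconditional content of this file: the general preimage lemma, the fibre count, the lift inequality and its iterate; nothing here is literature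
beyond the replication credited above.
-/

noncomputable section

namespace Summit.Ventures.DiscreteObjects.UnitDistance

open SimpleGraph Finset

/-! ## Independent sets pull back along graph homomorphisms -/

section Preimage

variable {V W : Type*} {G : SimpleGraph V} {H : SimpleGraph W}

/-- The preimage of an independent set under a graph homomorphism is independent. -/
theorem isIndepSet_preimage_of_hom (φ : G →g H) {s : Set W} (hs : H.IsIndepSet s) : G.IsIndepSet (φ ⁻¹' s) := by
  intro v hv w hw _ hadj
  exact hs hv hw (H.ne_of_adj (φ.map_adj hadj)) (φ.map_adj hadj)

variable [Fintype V] [DecidableEq W]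

/-- If every vertex fibre of a homomorphism `φ : G →g H` of finite graphs has at least `m` elements, then `m · α(H) ≤ α(G)`
(pull back a maximum independent set of `H`). -/
theorem mul_indepNum_le_indepNum_of_hom (φ : G →g H) (m : ℕ) (hm : ∀ w : W, m ≤ #(univ.filter fun v : V => φ v = w)) :
    m * H.indepNum ≤ G.indepNum := by
  obtain ⟨s, hs⟩ := H.exists_isNIndepSet_indepNum
  set t : Finset V := univ.filter fun v => φ v ∈ s with ht_def
  have ht : G.IsIndepSet (t : Set V) := by
    have h' := isIndepSet_preimage_of_hom φ hs.isIndepSet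
    intro v hv w hw hne hadj
    simp only [ht_def, coe_filter, mem_univ, true_and, Set.mem_setOf_eq] at hv hw
    exact h' hv hw hne hadj
  have hcard : #t = ∑ w ∈ s, #(t.filter fun v => φ v = w) :=
    card_eq_sum_card_fiberwise fun v hv => by simpa [ht_def] using hv
  have hfib : ∀ w ∈ s, m ≤ #(t.filter fun v => φ v = w) := by
    intro w hw
    refine (hm w).trans (card_le_card ?_)
    intro v hv
    simp only [mem_filter, mem_univ, true_and] at hv
    simp [ht_def, hv, hw]
  calc m * H.indepNum = ∑ _w ∈ s, m := by rw [sum_const, smul_eq_mul, hs.card_eq, mul_comm]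
    _ ≤ ∑ w ∈ s, #(t.filter fun v => φ v = w) := sum_le_sum hfib
    _ = #t := hcard.symm
    _ ≤ G.indepNum := ht.card_le_indepNum

end Preimage

/-! ## The fibres of `(ℤ/p^{k+1})² → (ℤ/p^k)²` have `p²` points -/

section Fibres

variable (p : ℕ)

/-- The coordinatewise reduction `(ℤ/p^(k+1))² → (ℤ/p^k)²` (as a bare function; it is the vertex map of the reduction homomorphism
`unitCircleGraph.map (ZMod.castHom _ (ZMod (p^k)))`). -/
theorem zmodPow_reduce₂_surjective (k : ℕ) :
    Function.Surjective (Prod.map (ZMod.castHom (pow_dvd_pow p (Nat.le_succ k)) (ZMod (p ^ k)))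
      (ZMod.castHom (pow_dvd_pow p (Nat.le_succ k)) (ZMod (p ^ k))) :
      ZMod (p ^ (k + 1)) × ZMod (p ^ (k + 1)) → ZMod (p ^ k) × ZMod (p ^ k)) := by
  intro w
  obtain ⟨a, ha⟩ := ZMod.castHom_surjective (pow_dvd_pow p (Nat.le_succ k)) (n := p ^ (k + 1)) w.1
  obtain ⟨b, hb⟩ := ZMod.castHom_surjective (pow_dvd_pow p (Nat.le_succ k)) (n := p ^ (k + 1)) w.2
  exact ⟨(a, b), Prod.ext ha hb⟩

/-- Every fibre of the coordinatewise reduction `(ℤ/p^(k+1))² → (ℤ/p^k)²` has exactly `p²` elements (all fibres of a surjective additive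
homomorphism have the same size, and they partition the `p^(2k+2)` points). -/
theorem card_fiber_zmodPow_reduce₂ [hp : Fact p.Prime] (k : ℕ) (w : ZMod (p ^ k) × ZMod (p ^ k)) :
    #(univ.filter fun v : ZMod (p ^ (k + 1)) × ZMod (p ^ (k + 1)) =>
        Prod.map (ZMod.castHom (pow_dvd_pow p (Nat.le_succ k)) (ZMod (p ^ k)))
          (ZMod.castHom (pow_dvd_pow p (Nat.le_succ k)) (ZMod (p ^ k))) v = w) = p ^ 2 := by
  classical
  let π : ZMod (p ^ (k + 1)) →+* ZMod (p ^ k) := ZMod.castHom (pow_dvd_pow p (Nat.le_succ k)) (ZMod (p ^ k))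
  let f : ZMod (p ^ (k + 1)) × ZMod (p ^ (k + 1)) →+ ZMod (p ^ k) × ZMod (p ^ k) :=
    π.toAddMonoidHom.prodMap π.toAddMonoidHom
  have hf : ∀ v, f v = Prod.map π π v := fun v => rfl
  have hsurj : Function.Surjective f := fun w' => by
    obtain ⟨v, hv⟩ := zmodPow_reduce₂_surjective p k w'
    exact ⟨v, by rw [hf]; exact hv⟩
  change #(univ.filter fun v => Prod.map π π v = w) = p ^ 2
  simp_rw [← hf]
  -- all fibres have the same size (surjective additive homomorphism)
  have heq : ∀ w' : ZMod (p ^ k) × ZMod (p ^ k), #(univ.filter fun v => f v = w') = #(univ.filter fun v => f v = w) :=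
    fun w' => AddMonoidHom.card_fiber_eq_of_mem_range f (hsurj w') (hsurj w)
  -- the fibres partition the source
  have hsum : Fintype.card (ZMod (p ^ (k + 1)) × ZMod (p ^ (k + 1))) =
      ∑ w' : ZMod (p ^ k) × ZMod (p ^ k), #(univ.filter fun v => f v = w') := by
    rw [← card_univ]
    exact card_eq_sum_card_fiberwise fun v _ => mem_univ (f v)
  simp_rw [heq] at hsum
  rw [sum_const, card_univ, smul_eq_mul, Fintype.card_prod, Fintype.card_prod, ZMod.card, ZMod.card] at hsum
  have hpos : 0 < p ^ k * p ^ k := Nat.mul_pos (pow_pos hp.out.pos k) (pow_pos hp.out.pos k)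
  have : p ^ (k + 1) * p ^ (k + 1) = p ^ k * p ^ k * p ^ 2 := by ring
  rw [this] at hsum
  exact (Nat.eq_of_mul_eq_mul_left hpos hsum).symm

end Fibres

/-! ## The lift inequality `p² · α(G_k(p)) ≤ α(G_{k+1}(p))` (Cioabă 2005, Thm 4.3.7, `n = 2`, `a = 1`) -/

section Lift

variable (p : ℕ) [hp : Fact p.Prime]

/-- CIOABĂ'S THEOREM 4.3.7 (second half; `n = 2`, `a = 1`): `p² · α(G_k(p)) ≤ α(G_{k+1}(p))` for every `k ≥ 1` — full fibres over an
independent set of the base are independent (pull back along the reduction homomorphism `unitCircleGraph.map (ℤ/p^(k+1) → ℤ/p^k)`, whose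
vertex fibres have `p²` points).  (First half, `χ(G_{k+1}(p)) ≤ χ(G_k(p))`: `unitCircleGraph_zmodPow_colorable_mono` in `PadicHigherReduction.lean`.) -/
theorem sq_mul_indepNum_le_indepNum_succ {k : ℕ} (hk : k ≠ 0) :
    p ^ 2 * (unitCircleGraph (ZMod (p ^ k))).indepNum ≤ (unitCircleGraph (ZMod (p ^ (k + 1)))).indepNum := by
  classical
  haveI : Fact (1 < p ^ k) := ⟨Nat.one_lt_pow hk hp.out.one_lt⟩
  let φ : unitCircleGraph (ZMod (p ^ (k + 1))) →g unitCircleGraph (ZMod (p ^ k)) :=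
    unitCircleGraph.map (ZMod.castHom (pow_dvd_pow p (Nat.le_succ k)) (ZMod (p ^ k)))
  have hφ : ∀ v, φ v = Prod.map (ZMod.castHom (pow_dvd_pow p (Nat.le_succ k)) (ZMod (p ^ k)))
      (ZMod.castHom (pow_dvd_pow p (Nat.le_succ k)) (ZMod (p ^ k))) v := fun v => rfl
  refine mul_indepNum_le_indepNum_of_hom φ (p ^ 2) fun w => le_of_eq ?_
  rw [← card_fiber_zmodPow_reduce₂ p k w]
  simp_rw [hφ]

/-- Iterated: `p^(2j) · α(G_k(p)) ≤ α(G_{k+j}(p))` (`k ≥ 1`): the independence RATIO `α(G_k(p))/p^(2k)` is non-decreasing in `k`. -/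
theorem pow_mul_indepNum_le_indepNum_add {k : ℕ} (hk : k ≠ 0) (j : ℕ) :
    p ^ (2 * j) * (unitCircleGraph (ZMod (p ^ k))).indepNum ≤ (unitCircleGraph (ZMod (p ^ (k + j)))).indepNum := by
  induction j with
  | zero => simp
  | succ j ih =>
    have hkj : k + j ≠ 0 := by omega
    calc p ^ (2 * (j + 1)) * (unitCircleGraph (ZMod (p ^ k))).indepNum
        = p ^ 2 * (p ^ (2 * j) * (unitCircleGraph (ZMod (p ^ k))).indepNum) := by ring
      _ ≤ p ^ 2 * (unitCircleGraph (ZMod (p ^ (k + j)))).indepNum := Nat.mul_le_mul_left _ ih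
      _ ≤ (unitCircleGraph (ZMod (p ^ (k + j + 1)))).indepNum := sq_mul_indepNum_le_indepNum_succ p hkj

end Lift

/-! ## Cioabă's conjecture (as explicit hypotheses) and what it would settle for the rows `47, 311, 335`

CIOABĂ'S LIFT CONJECTURE for the plane over `ℤ/p^k` (S. M. Cioabă, PhD thesis, Queen's Univ. 2005, remark after Thm 4.3.7, p. 56: "I believe that
equality holds in both of the previous results"; the case `n = 2`, `a = 1` of his graphs `X_{p^r}(n,a)`): for every `k ≥ 1`,
(α) `α(G_{k+1}(p)) = p² · α(G_k(p))` and (χ) `χ(G_{k+1}(p)) = χ(G_k(p))`.  OPEN; seat udg g19's 'lift conjecture' is (α).  Below the two halves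
appear only as HYPOTHESES `hα`, `hχ` of theorems (nothing is asserted).  For `n = 1` the analogous belief is false (odd cycles), so the plane is the
first meaningful case. -/

section Conjecture

/-- Under the chromatic half (χ) at `p`, every level has the chromatic number of the residue plane: `χ(G_k(p)) = χ(G_1(p))` (`k ≥ 1`). -/
theorem chromaticNumber_zmodPow_eq_of_chromatic_lift {p : ℕ}
    (hχ : ∀ k : ℕ, k ≠ 0 → (unitCircleGraph (ZMod (p ^ (k + 1)))).chromaticNumber = (unitCircleGraph (ZMod (p ^ k))).chromaticNumber)
    {k : ℕ} (hk : k ≠ 0) :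
    (unitCircleGraph (ZMod (p ^ k))).chromaticNumber = (unitCircleGraph (ZMod (p ^ 1))).chromaticNumber := by
  induction k with
  | zero => exact absurd rfl hk
  | succ k ih =>
    rcases Nat.eq_zero_or_pos k with rfl | hkpos
    · rfl
    · rw [hχ k hkpos.ne', ih hkpos.ne']

/-- Under the independence half (α) at `p`, `α(G_k(p)) = p^(2(k−1)) · α(G_1(p))` for every `k ≥ 1`. -/
theorem indepNum_zmodPow_eq_of_indep_lift {p : ℕ}
    (hα : ∀ k : ℕ, k ≠ 0 → (unitCircleGraph (ZMod (p ^ (k + 1)))).indepNum = p ^ 2 * (unitCircleGraph (ZMod (p ^ k))).indepNum)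
    {k : ℕ} (hk : k ≠ 0) :
    (unitCircleGraph (ZMod (p ^ k))).indepNum = p ^ (2 * (k - 1)) * (unitCircleGraph (ZMod (p ^ 1))).indepNum := by
  induction k with
  | zero => exact absurd rfl hk
  | succ k ih =>
    rcases Nat.eq_zero_or_pos k with rfl | hkpos
    · simp
    · rw [hα k hkpos.ne', ih hkpos.ne']
      have : 2 * (k + 1 - 1) = 2 + 2 * (k - 1) := by omega
      rw [this, pow_add, mul_assoc]

/-- `p = 11`, chromatic half ⇒ NO reduction graph `G_k(11)` (`k ≥ 1`) is `4`-colourable (kernel input: `G_1(11) = UD(𝔽₁₁²)` is not,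
`not_colorable_four_zmod11`). -/
theorem not_colorable_four_zmodPow11_of_chromatic_lift
    (hχ : ∀ k : ℕ, k ≠ 0 → (unitCircleGraph (ZMod (11 ^ (k + 1)))).chromaticNumber = (unitCircleGraph (ZMod (11 ^ k))).chromaticNumber)
    {k : ℕ} (hk : k ≠ 0) : ¬ (unitCircleGraph (ZMod (11 ^ k))).Colorable 4 := by
  intro hc
  have h1 : (unitCircleGraph (ZMod (11 ^ 1))).chromaticNumber ≤ 4 := by
    rw [← chromaticNumber_zmodPow_eq_of_chromatic_lift hχ hk]; exact hc.chromaticNumber_le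
  have h1' : (unitCircleGraph (ZMod 11)).chromaticNumber ≤ (4 : ℕ) := by simpa using h1
  exact not_colorable_four_zmod11 (chromaticNumber_le_iff_colorable.mp h1')

/-- `p = 19`, chromatic half ⇒ NO reduction graph `G_k(19)` (`k ≥ 1`) is `4`-colourable (kernel input: `not_colorable_four_zmod19`). -/
theorem not_colorable_four_zmodPow19_of_chromatic_lift
    (hχ : ∀ k : ℕ, k ≠ 0 → (unitCircleGraph (ZMod (19 ^ (k + 1)))).chromaticNumber = (unitCircleGraph (ZMod (19 ^ k))).chromaticNumber)
    {k : ℕ} (hk : k ≠ 0) : ¬ (unitCircleGraph (ZMod (19 ^ k))).Colorable 4 := by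
  intro hc
  have h1 : (unitCircleGraph (ZMod (19 ^ 1))).chromaticNumber ≤ 4 := by
    rw [← chromaticNumber_zmodPow_eq_of_chromatic_lift hχ hk]; exact hc.chromaticNumber_le
  have h1' : (unitCircleGraph (ZMod 19)).chromaticNumber ≤ (4 : ℕ) := by simpa using h1
  exact not_colorable_four_zmod19 (chromaticNumber_le_iff_colorable.mp h1')

/-- `p = 11`, INDEPENDENCE half + the census value of the residue plane: if `α(G_{k+1}(11)) = 121 · α(G_k(11))` for all `k ≥ 1` and
`α(UD(𝔽₁₁²)) ≤ 30` (the cell's exact value is `28`, two engines, not a kernel fact; `30` is all that is needed: `4 · 30 < 121`), then no `G_k(11)`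
is `4`-colourable — colour classes are independent sets (`card_le_mul_indepNum_of_colorable`). -/
theorem not_colorable_four_zmodPow11_of_indep_lift
    (hα : ∀ k : ℕ, k ≠ 0 → (unitCircleGraph (ZMod (11 ^ (k + 1)))).indepNum = 11 ^ 2 * (unitCircleGraph (ZMod (11 ^ k))).indepNum)
    (h30 : (unitCircleGraph (ZMod 11)).indepNum ≤ 30) {k : ℕ} (hk : k ≠ 0) :
    ¬ (unitCircleGraph (ZMod (11 ^ k))).Colorable 4 := by
  intro hc
  have hcard := card_le_mul_indepNum_of_colorable (unitCircleGraph (ZMod (11 ^ k))) hc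
  rw [indepNum_zmodPow_eq_of_indep_lift hα hk, Fintype.card_prod, ZMod.card] at hcard
  have h30' : (unitCircleGraph (ZMod (11 ^ 1))).indepNum ≤ 30 := by simpa using h30
  have hle : 11 ^ k * 11 ^ k ≤ 4 * (11 ^ (2 * (k - 1)) * 30) :=
    hcard.trans (Nat.mul_le_mul_left _ (Nat.mul_le_mul_left _ h30'))
  obtain ⟨j, rfl⟩ : ∃ j, k = j + 1 := ⟨k - 1, by omega⟩
  have hj : 2 * (j + 1 - 1) = 2 * j := by omega
  rw [hj] at hle
  have key : 4 * (11 ^ (2 * j) * 30) < 11 ^ (j + 1) * 11 ^ (j + 1) := by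
    have : 11 ^ (j + 1) * 11 ^ (j + 1) = 121 * 11 ^ (2 * j) := by ring
    rw [this]
    have hpos : 0 < 11 ^ (2 * j) := pow_pos (by norm_num) _
    nlinarith
  exact absurd hle (not_le.mpr key)

/-- THE REDUCTION ROUTE IS CLOSED UNDER CIOABĂ'S CONJECTURE (chromatic halves at `11` and `19`): the hypothesis "some `G_k(11)` or some `G_k(19)`
is `4`-colourable" of the conditional row theorems (`chromaticNumber_plane_sqrt47_eq_four_of_zmodPow`, `…311…`, `…335…` in
`PadicHigherReduction.lean`) is then unsatisfiable — the rows `47, 311, 335` would be decided only by a `5`-chromatic unit-distance graph over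
`ℚ(√d)` or by a non-periodic `4`-colouring of the `11`- or `19`-adic plane. -/
theorem reduction_route_closed_of_chromatic_lift
    (h11 : ∀ k : ℕ, k ≠ 0 → (unitCircleGraph (ZMod (11 ^ (k + 1)))).chromaticNumber = (unitCircleGraph (ZMod (11 ^ k))).chromaticNumber)
    (h19 : ∀ k : ℕ, k ≠ 0 → (unitCircleGraph (ZMod (19 ^ (k + 1)))).chromaticNumber = (unitCircleGraph (ZMod (19 ^ k))).chromaticNumber) :
    ¬ ((∃ k ≠ 0, (unitCircleGraph (ZMod (11 ^ k))).Colorable 4) ∨ (∃ k ≠ 0, (unitCircleGraph (ZMod (19 ^ k))).Colorable 4)) := by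
  rintro (⟨k, hk, hc⟩ | ⟨k, hk, hc⟩)
  · exact not_colorable_four_zmodPow11_of_chromatic_lift h11 hk hc
  · exact not_colorable_four_zmodPow19_of_chromatic_lift h19 hk hc

/-- Conversely a `4`-colourable `G_k(11)` — the object seat udg g19's farm instances (`G₃(11)`, and `G₂(19)` for `19`) ask for — would REFUTE the
chromatic half of Cioabă's conjecture at `11` (and close the rows at `4`). -/
theorem chromatic_lift_false_of_colorable_four_zmodPow11 {k : ℕ} (hk : k ≠ 0) (hc : (unitCircleGraph (ZMod (11 ^ k))).Colorable 4) :
    ¬ (∀ k : ℕ, k ≠ 0 → (unitCircleGraph (ZMod (11 ^ (k + 1)))).chromaticNumber = (unitCircleGraph (ZMod (11 ^ k))).chromaticNumber) :=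
  fun h => not_colorable_four_zmodPow11_of_chromatic_lift h hk hc

end Conjecture

end Summit.Ventures.DiscreteObjects.UnitDistance

end
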